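import Literature.Probability.Percolation.ArmSeparationRing
import HarnessLib

/-!
# Thin chunked ring roads and their arcs

Topic: Probability / Percolation; family `crit-perc`. A toolkit brick of the discharge of
`Literature.Probability.Percolation.Nolin2008_twoArm_separation` (Nolin 2008, Thm. 11
[arXiv 0711.4948: Thm. 10]; `ArmSeparation.lean`), landing step of the internal extremities
(Nolin 2008, Prop. 12 (iii)–(i) [arXiv Prop. 11]: RSW corridors). The ring roads of
`ArmSeparationRing.lean` are refined into **chunked** rings all of whose tubes are small
(`(s + 2e) × 2e`): the straight sides become alternating sequences of side pieces of length `s`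
and square connectors (`vchunks`, `hchunks`), the diagonal sides are the staircases `stair` of
step `s`. A corridor then uses an **arc**: a contiguous run of the cyclic ring (`Tube.arc`), read
in either direction (`Tube.crosses_symm`: the plus-sign relation is symmetric, so reversed runs are
chains too). Fine chunks let an arc start right at the tube met by the incoming corridor and stop
short of any prescribed small region further along the ring.

* `vPiece/vConn/vchunks`, `hPiece/hConn/hchunks` — chunked vertical / horizontal sides, chains,
  membership, norms, aspect ratios;
* `thinHalfRing r e s`, `thinRing r e s` — the chunked ring around `|v| = r` (`s ∣ r`), with
  `isChain_thinRing`, `crosses_thinRing_close`, `triNorm_mem_of_mem_thinRing`,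
  `aspectLE_of_mem_thinRing`;
* generic chain bookkeeping: `Tube.crosses_symm`, `Tube.isChain_reverse`, `Tube.isChain_rotate`,
  `Tube.isChain_take`, and `Tube.arc L a len = (L.rotate a).take len` with `Tube.isChain_arc`,
  `Tube.mem_of_mem_arc`.

## References

* P. Nolin, *Near-critical percolation in two dimensions*, Electron. J. Probab. 13 (2008), §4.3,
  Prop. 12 (proof) [arXiv 0711.4948: Prop. 11]. [Nolin2008]
* H. Kesten, *Scaling relations for 2D-percolation*, Comm. Math. Phys. 109 (1987), Lemma 2. [Kesten1987]
-/

noncomputable section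

open Set

namespace Literature.Probability.Percolation

open LatticeModels Tube

/-! ### Generic chain bookkeeping -/

namespace Tube

/-- The plus-sign relation is symmetric. [folklore] -/
theorem crosses_symm {T T' : Tube} (h : Crosses T T') : Crosses T' T := by
  rcases h with ⟨h1, h2, h3, h4, h5, h6⟩ | ⟨h1, h2, h3, h4, h5, h6⟩
  · exact Or.inr ⟨h2, h1, h3, h4, h5, h6⟩
  · exact Or.inl ⟨h2, h1, h3, h4, h5, h6⟩

/-- A reversed chain of crossing tubes is a chain. [folklore] -/
theorem isChain_reverse {L : List Tube} (h : List.IsChain Crosses L) : List.IsChain Crosses L.reverse := by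
  rw [List.isChain_reverse]
  exact List.IsChain.imp (fun _ _ hab => crosses_symm hab) h

/-- A prefix of a chain is a chain. [folklore] -/
theorem isChain_take {L : List Tube} (h : List.IsChain Crosses L) (n : ℕ) : List.IsChain Crosses (L.take n) := by
  rw [← List.take_append_drop n L] at h
  exact h.left_of_append

/-- A suffix of a chain is a chain. [folklore] -/
theorem isChain_drop {L : List Tube} (h : List.IsChain Crosses L) (n : ℕ) : List.IsChain Crosses (L.drop n) := by
  rw [← List.take_append_drop n L] at h
  exact h.right_of_append

/-- **Rotating a closed chain**: if `L` is a chain and its last tube crosses its first, every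
rotation of `L` is a chain. [folklore] -/
theorem isChain_rotate {L : List Tube} (h : List.IsChain Crosses L)
    (hc : ∀ x ∈ L.getLast?, ∀ y ∈ L.head?, Crosses x y) (n : ℕ) : List.IsChain Crosses (L.rotate n) := by
  rw [List.rotate_eq_drop_append_take_mod]
  set k := n % L.length with hk
  have h1 := isChain_drop h k
  have h2 := isChain_take h k
  refine List.IsChain.append h1 h2 ?_
  intro x hx y hy
  by_cases hkl : k < L.length
  · -- the junction is the closing one: last of `drop k` is the last of `L`, head of `take k` is the head of `L` (if `k > 0`)
    have hx' : x ∈ L.getLast? := by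
      rw [List.getLast?_drop, if_neg (not_le.2 hkl)] at hx
      exact hx
    rcases Nat.eq_zero_or_pos k with hk0 | hk0
    · rw [hk0, List.take_zero] at hy; simp at hy
    · have hy' : y ∈ L.head? := by
        rw [List.head?_take, if_neg hk0.ne'] at hy
        exact hy
      exact hc x hx' y hy'
  · rw [List.drop_eq_nil_of_le (not_lt.1 hkl)] at hx
    simp at hx

/-- **Chains with prescribed crossings**: if consecutive tubes of `T₀ :: L` cross and `X T, Y T`
is a crossing of every tube `T` of the list in `ω`, then every start `X T` is joined to the first
start `X T₀` by an open path inside the union of the boxes (so that runs of the same list, read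
with the same crossings, share their paths). [cite: Nolin2008, §4.3 Prop. 12 (proof) (arXiv 0711.4948: Prop. 11)] -/
theorem chain_paths' {ω : SiteConfig (Site 2)} (X Y : Tube → Site 2) :
    ∀ (T₀ : Tube) (L : List Tube), List.IsChain Crosses (T₀ :: L) → (∀ T ∈ T₀ :: L, T.IsCrossing ω (X T) (Y T)) →
      ∀ T ∈ T₀ :: L, PathIn triGraph (boxAll (T₀ :: L) ∩ ω) (X T₀) (X T)
  | T₀, [], _, hX, T, hT => by
    rw [List.mem_singleton] at hT
    subst hT
    have h := (hX T List.mem_cons_self).2.left_mem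
    exact PathIn.refl ⟨⟨T, List.mem_cons_self, h.1⟩, h.2⟩
  | T₀, T₁ :: L, hch, hX, T, hT => by
    have h0 := hX T₀ List.mem_cons_self
    have h1 := hX T₁ (List.mem_cons_of_mem _ List.mem_cons_self)
    rcases List.mem_cons.1 hT with rfl | hT'
    · exact PathIn.refl ⟨⟨T, List.mem_cons_self, h0.2.left_mem.1⟩, h0.2.left_mem.2⟩
    · have ih := chain_paths' X Y T₁ L hch.tail (fun T hT => hX T (List.mem_cons_of_mem _ hT)) T hT'
      have r := relay hch.rel h0 h1
      refine (r.mono ?_).trans (ih.mono ?_)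
      · rintro v ⟨hv | hv, hvω⟩
        · exact ⟨⟨T₀, List.mem_cons_self, hv⟩, hvω⟩
        · exact ⟨⟨T₁, List.mem_cons_of_mem _ List.mem_cons_self, hv⟩, hvω⟩
      · rintro v ⟨⟨T', hT', hv⟩, hvω⟩
        exact ⟨⟨T', List.mem_cons_of_mem _ hT', hv⟩, hvω⟩

/-- All tubes of a list realised by `ω` admit a simultaneous choice of crossings. [folklore] -/
theorem exists_crossings {ω : SiteConfig (Site 2)} {L : List Tube} (h : ∀ T ∈ L, ω ∈ T.event) :
    ∃ X Y : Tube → Site 2, ∀ T ∈ L, T.IsCrossing ω (X T) (Y T) := by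
  classical
  have key : ∀ T : Tube, ∃ xy : Site 2 × Site 2, T ∈ L → T.IsCrossing ω xy.1 xy.2 := by
    intro T
    by_cases hT : T ∈ L
    · obtain ⟨x, y, hxy⟩ := T.exists_isCrossing (h T hT); exact ⟨(x, y), fun _ => hxy⟩
    · exact ⟨(0, 0), fun h' => absurd h' hT⟩
  choose f hf using key
  exact ⟨fun T => (f T).1, fun T => (f T).2, fun T hT => hf T hT⟩

/-- **An arc**: `len` consecutive tubes of the cyclic list `L`, starting at position `a`. [cite: Nolin2008, §4.3 Prop. 12 (proof) (arXiv 0711.4948: Prop. 11)] -/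
def arc (L : List Tube) (a len : ℕ) : List Tube := (L.rotate a).take len

/-- Arcs of a closed chain are chains. [folklore] -/
theorem isChain_arc {L : List Tube} (h : List.IsChain Crosses L) (hc : ∀ x ∈ L.getLast?, ∀ y ∈ L.head?, Crosses x y)
    (a len : ℕ) : List.IsChain Crosses (arc L a len) :=
  isChain_take (isChain_rotate h hc a) len

/-- The tubes of an arc are tubes of the ring. [folklore] -/
theorem mem_of_mem_arc {L : List Tube} {a len : ℕ} {T : Tube} (hT : T ∈ arc L a len) : T ∈ L :=
  (List.mem_rotate).1 (List.mem_of_mem_take hT)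

/-- The first tube of an arc (`1 ≤ len`, `a < |L|`). [folklore] -/
theorem head?_arc {L : List Tube} {a len : ℕ} (hlen : 1 ≤ len) (ha : a < L.length) : (arc L a len).head? = L[a]? := by
  unfold arc
  rw [List.head?_take, if_neg (by omega), List.head?_rotate ha]

/-- The `i`-th tube of an arc is the `(i + a) mod |L|`-th tube of the ring (`i < len`, `i < |L|`). [folklore] -/
theorem getElem?_arc {L : List Tube} {a len i : ℕ} (hi : i < len) (hiL : i < L.length) :
    (arc L a len)[i]? = L[(i + a) % L.length]? := by
  unfold arc
  rw [List.getElem?_take_of_lt hi, List.getElem?_rotate hiL]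

/-- A tube listed in an arc belongs to it: `L[(i + a) mod |L|] ∈ arc L a len` for `i < len`, `i < |L|`. [folklore] -/
theorem getElem_mem_arc {L : List Tube} {a len i : ℕ} (hi : i < len) (hiL : i < L.length) :
    L[(i + a) % L.length]'(Nat.mod_lt _ (by omega)) ∈ arc L a len := by
  have h := getElem?_arc (a := a) hi hiL
  rw [List.getElem?_eq_getElem (Nat.mod_lt _ (by omega))] at h
  exact List.mem_of_getElem? h

/-- The length of an arc (`len ≤ |L|`). [folklore] -/
theorem length_arc {L : List Tube} {a len : ℕ} (h : len ≤ L.length) : (arc L a len).length = len := by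
  unfold arc; rw [List.length_take, List.length_rotate]; exact Nat.min_eq_left h

end Tube

/-! ### Chunked straight sides -/

/-- The `j`-th piece of the vertical side `x₀ = x` read upwards from the row `y₀`: the tube
`[x - e, x + e] × [y₀ + js - e, y₀ + (j+1)s + e]` crossed vertically. [folklore] -/
def vPiece (x y₀ : ℤ) (e s j : ℕ) : Tube := ⟨x - e, y₀ + j * s - e, 2 * e, s + 2 * e, false⟩

/-- The connector after the `j`-th vertical piece: the square
`[x - e, x + e] × [y₀ + (j+1)s - e, y₀ + (j+1)s + e]` crossed horizontally. [folklore] -/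
def vConn (x y₀ : ℤ) (e s j : ℕ) : Tube := ⟨x - e, y₀ + (j + 1) * s - e, 2 * e, 2 * e, true⟩

/-- The chunked vertical side: `d` pieces from the `j`-th one, with connectors in between
(`V_j, C_j, V_{j+1}, …, V_{j+d-1}`; no trailing connector). [folklore] -/
def vchunks (x y₀ : ℤ) (e s : ℕ) : ℕ → ℕ → List Tube
  | _, 0 => []
  | j, 1 => [vPiece x y₀ e s j]
  | j, d + 2 => vPiece x y₀ e s j :: vConn x y₀ e s j :: vchunks x y₀ e s (j + 1) (d + 1)

/-- The `j`-th piece of the horizontal side `x₁ = y` read leftwards from the column `x₀`: the tube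
`[x₀ - (j+1)s - e, x₀ - js + e] × [y - e, y + e]` crossed horizontally. [folklore] -/
def hPiece (x₀ y : ℤ) (e s j : ℕ) : Tube := ⟨x₀ - (j + 1) * s - e, y - e, s + 2 * e, 2 * e, true⟩

/-- The connector after the `j`-th horizontal piece: the square
`[x₀ - (j+1)s - e, x₀ - (j+1)s + e] × [y - e, y + e]` crossed vertically. [folklore] -/
def hConn (x₀ y : ℤ) (e s j : ℕ) : Tube := ⟨x₀ - (j + 1) * s - e, y - e, 2 * e, 2 * e, false⟩

/-- The chunked horizontal side: `d` pieces from the `j`-th one, with connectors in between. [folklore] -/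
def hchunks (x₀ y : ℤ) (e s : ℕ) : ℕ → ℕ → List Tube
  | _, 0 => []
  | j, 1 => [hPiece x₀ y e s j]
  | j, d + 2 => hPiece x₀ y e s j :: hConn x₀ y e s j :: hchunks x₀ y e s (j + 1) (d + 1)

section Chunks

variable (x y₀ : ℤ) (e s : ℕ)

/-- `V_j` crosses `C_j`. [folklore] -/
theorem crosses_vPiece_vConn (j : ℕ) : Crosses (vPiece x y₀ e s j) (vConn x y₀ e s j) := by
  refine Or.inr ⟨rfl, rfl, ?_, ?_, ?_, ?_⟩ <;> simp only [vPiece, vConn] <;> push_cast <;> nlinarith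

/-- `C_j` crosses `V_{j+1}`. [folklore] -/
theorem crosses_vConn_vPiece (j : ℕ) : Crosses (vConn x y₀ e s j) (vPiece x y₀ e s (j + 1)) := by
  refine Or.inl ⟨rfl, rfl, ?_, ?_, ?_, ?_⟩ <;> simp only [vPiece, vConn] <;> push_cast <;> nlinarith

/-- `H_j` crosses `D_j` (horizontal side). [folklore] -/
theorem crosses_hPiece_hConn (j : ℕ) : Crosses (hPiece x y₀ e s j) (hConn x y₀ e s j) := by
  refine Or.inl ⟨rfl, rfl, ?_, ?_, ?_, ?_⟩ <;> simp only [hPiece, hConn] <;> push_cast <;> nlinarith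

/-- `D_j` crosses `H_{j+1}` (horizontal side). [folklore] -/
theorem crosses_hConn_hPiece (j : ℕ) : Crosses (hConn x y₀ e s j) (hPiece x y₀ e s (j + 1)) := by
  refine Or.inr ⟨rfl, rfl, ?_, ?_, ?_, ?_⟩ <;> simp only [hPiece, hConn] <;> push_cast <;> nlinarith

/-- The head of a nonempty chunked vertical side. [folklore] -/
theorem head?_vchunks (j d : ℕ) : (vchunks x y₀ e s j (d + 1)).head? = some (vPiece x y₀ e s j) := by
  cases d <;> rfl

/-- The head of a nonempty chunked horizontal side. [folklore] -/
theorem head?_hchunks (j d : ℕ) : (hchunks x y₀ e s j (d + 1)).head? = some (hPiece x y₀ e s j) := by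
  cases d <;> rfl

/-- The last tube of a nonempty chunked vertical side is its last piece. [folklore] -/
theorem getLast?_vchunks : ∀ j d : ℕ, (vchunks x y₀ e s j (d + 1)).getLast? = some (vPiece x y₀ e s (j + d))
  | j, 0 => rfl
  | j, d + 1 => by
    rw [vchunks, List.getLast?_cons_cons, ← List.getLast?_cons_cons (a := vPiece x y₀ e s j)]
    have := getLast?_vchunks (j + 1) d
    rw [Nat.add_right_comm, Nat.add_assoc] at this
    cases d with
    | zero => rfl
    | succ d => simpa [vchunks] using this

/-- The last tube of a nonempty chunked horizontal side is its last piece. [folklore] -/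
theorem getLast?_hchunks : ∀ j d : ℕ, (hchunks x y₀ e s j (d + 1)).getLast? = some (hPiece x y₀ e s (j + d))
  | j, 0 => rfl
  | j, d + 1 => by
    rw [hchunks, List.getLast?_cons_cons, ← List.getLast?_cons_cons (a := hPiece x y₀ e s j)]
    have := getLast?_hchunks (j + 1) d
    rw [Nat.add_right_comm, Nat.add_assoc] at this
    cases d with
    | zero => rfl
    | succ d => simpa [hchunks] using this

/-- The chunked vertical side is a chain. [folklore] -/
theorem isChain_vchunks : ∀ j d : ℕ, List.IsChain Crosses (vchunks x y₀ e s j d)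
  | _, 0 => List.isChain_nil
  | _, 1 => List.isChain_singleton _
  | j, d + 2 => by
    rw [vchunks]
    refine List.IsChain.cons_cons (crosses_vPiece_vConn x y₀ e s j)
      (List.IsChain.cons (isChain_vchunks (j + 1) (d + 1)) fun y hy => ?_)
    rw [head?_vchunks] at hy
    simp only [Option.mem_def, Option.some.injEq] at hy
    rw [← hy]; exact crosses_vConn_vPiece x y₀ e s j

/-- The chunked horizontal side is a chain. [folklore] -/
theorem isChain_hchunks : ∀ j d : ℕ, List.IsChain Crosses (hchunks x y₀ e s j d)
  | _, 0 => List.isChain_nil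
  | _, 1 => List.isChain_singleton _
  | j, d + 2 => by
    rw [hchunks]
    refine List.IsChain.cons_cons (crosses_hPiece_hConn x y₀ e s j)
      (List.IsChain.cons (isChain_hchunks (j + 1) (d + 1)) fun y hy => ?_)
    rw [head?_hchunks] at hy
    simp only [Option.mem_def, Option.some.injEq] at hy
    rw [← hy]; exact crosses_hConn_hPiece x y₀ e s j

/-- Membership in the chunked vertical side. [folklore] -/
theorem mem_vchunks : ∀ {j d : ℕ} {T : Tube}, T ∈ vchunks x y₀ e s j d →
    ∃ i, j ≤ i ∧ i < j + d ∧ (T = vPiece x y₀ e s i ∨ (T = vConn x y₀ e s i ∧ i + 1 < j + d))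
  | _, 0, _, hT => by simp [vchunks] at hT
  | j, 1, T, hT => by
    simp only [vchunks, List.mem_singleton] at hT
    exact ⟨j, le_rfl, by omega, Or.inl hT⟩
  | j, d + 2, T, hT => by
    rw [vchunks] at hT
    simp only [List.mem_cons] at hT
    rcases hT with rfl | rfl | hT
    · exact ⟨j, le_rfl, by omega, Or.inl rfl⟩
    · exact ⟨j, le_rfl, by omega, Or.inr ⟨rfl, by omega⟩⟩
    · obtain ⟨i, h1, h2, h3⟩ := mem_vchunks hT
      exact ⟨i, by omega, by omega, h3.imp id fun h => ⟨h.1, by omega⟩⟩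

/-- Membership in the chunked horizontal side. [folklore] -/
theorem mem_hchunks : ∀ {j d : ℕ} {T : Tube}, T ∈ hchunks x y₀ e s j d →
    ∃ i, j ≤ i ∧ i < j + d ∧ (T = hPiece x y₀ e s i ∨ (T = hConn x y₀ e s i ∧ i + 1 < j + d))
  | _, 0, _, hT => by simp [hchunks] at hT
  | j, 1, T, hT => by
    simp only [hchunks, List.mem_singleton] at hT
    exact ⟨j, le_rfl, by omega, Or.inl hT⟩
  | j, d + 2, T, hT => by
    rw [hchunks] at hT
    simp only [List.mem_cons] at hT
    rcases hT with rfl | rfl | hT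
    · exact ⟨j, le_rfl, by omega, Or.inl rfl⟩
    · exact ⟨j, le_rfl, by omega, Or.inr ⟨rfl, by omega⟩⟩
    · obtain ⟨i, h1, h2, h3⟩ := mem_hchunks hT
      exact ⟨i, by omega, by omega, h3.imp id fun h => ⟨h.1, by omega⟩⟩

/-- The boxes of the chunked vertical side lie in the slab `[x - e, x + e] × [y₀ + js - e, y₀ + (j+d)s + e]`. [folklore] -/
theorem bounds_of_mem_vchunks {j d : ℕ} {T : Tube} (hT : T ∈ vchunks x y₀ e s j d) {v : Site 2} (hv : v ∈ T.box) :
    x - e ≤ v 0 ∧ v 0 ≤ x + e ∧ y₀ + j * s - e ≤ v 1 ∧ v 1 ≤ y₀ + (j + d) * s + e := by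
  obtain ⟨i, h1, h2, h3⟩ := mem_vchunks x y₀ e s hT
  have hi1 : (j : ℤ) * s ≤ (i : ℤ) * s := by exact_mod_cast Nat.mul_le_mul_right s h1
  have hi2 : ((i : ℤ) + 1) * s ≤ ((j : ℤ) + d) * s := by
    exact_mod_cast Nat.mul_le_mul_right s (show i + 1 ≤ j + d by omega)
  have hs0 : (0 : ℤ) ≤ s := by positivity
  rcases h3 with rfl | ⟨rfl, -⟩
  · rw [Tube.mem_box] at hv; simp only [vPiece] at hv; push_cast at hv
    refine ⟨by linarith, by linarith, by linarith, by nlinarith⟩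
  · rw [Tube.mem_box] at hv; simp only [vConn] at hv; push_cast at hv
    refine ⟨by linarith, by linarith, by nlinarith, by nlinarith⟩

/-- The boxes of the chunked horizontal side lie in the slab `[x₀ - (j+d)s - e, x₀ - js + e] × [y - e, y + e]`. [folklore] -/
theorem bounds_of_mem_hchunks {j d : ℕ} {T : Tube} (hT : T ∈ hchunks x y₀ e s j d) {v : Site 2} (hv : v ∈ T.box) :
    x - (j + d) * s - e ≤ v 0 ∧ v 0 ≤ x - j * s + e ∧ y₀ - e ≤ v 1 ∧ v 1 ≤ y₀ + e := by
  obtain ⟨i, h1, h2, h3⟩ := mem_hchunks x y₀ e s hT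
  have hi1 : (j : ℤ) * s ≤ (i : ℤ) * s := by exact_mod_cast Nat.mul_le_mul_right s h1
  have hi2 : ((i : ℤ) + 1) * s ≤ ((j : ℤ) + d) * s := by
    exact_mod_cast Nat.mul_le_mul_right s (show i + 1 ≤ j + d by omega)
  have hs0 : (0 : ℤ) ≤ s := by positivity
  rcases h3 with rfl | ⟨rfl, -⟩
  · rw [Tube.mem_box] at hv; simp only [hPiece] at hv; push_cast at hv
    refine ⟨by linarith, by nlinarith, by linarith, by linarith⟩
  · rw [Tube.mem_box] at hv; simp only [hConn] at hv; push_cast at hv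
    refine ⟨by linarith, by nlinarith, by linarith, by linarith⟩

/-- The tubes of the chunked sides have aspect ratio at most `ρ` when `s + 2e ≤ 2ρe`, `1 ≤ e`. [folklore] -/
theorem aspectLE_of_mem_vchunks {j d ρ : ℕ} (he : 1 ≤ e) (hρ : s + 2 * e ≤ ρ * (2 * e)) {T : Tube}
    (hT : T ∈ vchunks x y₀ e s j d) : T.AspectLE ρ := by
  obtain ⟨i, -, -, rfl | ⟨rfl, -⟩⟩ := mem_vchunks x y₀ e s hT
  · simp only [AspectLE, vPiece, cond_false]; omega
  · simp only [AspectLE, vConn, cond_true]; constructor <;> nlinarith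

/-- The tubes of the chunked horizontal sides have aspect ratio at most `ρ`. [folklore] -/
theorem aspectLE_of_mem_hchunks {j d ρ : ℕ} (he : 1 ≤ e) (hρ : s + 2 * e ≤ ρ * (2 * e)) {T : Tube}
    (hT : T ∈ hchunks x y₀ e s j d) : T.AspectLE ρ := by
  obtain ⟨i, -, -, rfl | ⟨rfl, -⟩⟩ := mem_hchunks x y₀ e s hT
  · simp only [AspectLE, hPiece, cond_true]; omega
  · simp only [AspectLE, hConn, cond_false]; constructor <;> nlinarith

/-- Length of the chunked vertical side: `2d - 1` tubes (`d ≥ 1`). [folklore] -/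
theorem length_vchunks : ∀ j d : ℕ, (vchunks x y₀ e s j (d + 1)).length = 2 * d + 1
  | _, 0 => rfl
  | j, d + 1 => by rw [vchunks, List.length_cons, List.length_cons, length_vchunks (j + 1) d]; omega

/-- Length of the chunked horizontal side. [folklore] -/
theorem length_hchunks : ∀ j d : ℕ, (hchunks x y₀ e s j (d + 1)).length = 2 * d + 1
  | _, 0 => rfl
  | j, d + 1 => by rw [hchunks, List.length_cons, List.length_cons, length_hchunks (j + 1) d]; omega

/-- Even positions of the chunked vertical side are the pieces. [folklore] -/
theorem getElem?_vchunks_even : ∀ (j d i : ℕ), i < d → (vchunks x y₀ e s j d)[2 * i]? = some (vPiece x y₀ e s (j + i))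
  | _, 0, _, h => by omega
  | j, 1, i, h => by
    have : i = 0 := by omega
    subst this; rfl
  | j, d + 2, 0, _ => rfl
  | j, d + 2, i + 1, h => by
    rw [vchunks, show 2 * (i + 1) = 2 * i + 1 + 1 by ring, List.getElem?_cons_succ, List.getElem?_cons_succ,
      getElem?_vchunks_even (j + 1) (d + 1) i (by omega), Nat.add_right_comm, Nat.add_assoc]

/-- Even positions of the chunked horizontal side are the pieces. [folklore] -/
theorem getElem?_hchunks_even : ∀ (j d i : ℕ), i < d → (hchunks x y₀ e s j d)[2 * i]? = some (hPiece x y₀ e s (j + i))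
  | _, 0, _, h => by omega
  | j, 1, i, h => by
    have : i = 0 := by omega
    subst this; rfl
  | j, d + 2, 0, _ => rfl
  | j, d + 2, i + 1, h => by
    rw [hchunks, show 2 * (i + 1) = 2 * i + 1 + 1 by ring, List.getElem?_cons_succ, List.getElem?_cons_succ,
      getElem?_hchunks_even (j + 1) (d + 1) i (by omega), Nat.add_right_comm, Nat.add_assoc]

end Chunks

/-- Even positions of the staircase are the horizontal steps. [folklore] -/
theorem getElem?_stair_even (r e s : ℕ) : ∀ (j d i : ℕ), i < d → (stair r e s j d)[2 * i]? = some (stairH r e s (j + i))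
  | _, 0, _, h => by omega
  | j, d + 1, 0, _ => rfl
  | j, d + 1, i + 1, h => by
    rw [stair, show 2 * (i + 1) = 2 * i + 1 + 1 by ring, List.getElem?_cons_succ, List.getElem?_cons_succ,
      getElem?_stair_even r e s (j + 1) d i (by omega), Nat.add_right_comm, Nat.add_assoc]

/-- Length of the staircase: `2d` tubes. [folklore] -/
theorem length_stair (r e s : ℕ) : ∀ j d : ℕ, (stair r e s j d).length = 2 * d
  | _, 0 => rfl
  | j, d + 1 => by rw [stair, List.length_cons, List.length_cons, length_stair r e s (j + 1) d]; omega

/-! ### The thin ring -/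

/-- **Half of the thin ring** around `|v| = r` (`n = r / s` chunks per side): the chunked side
`x₀ = r` from `(r, -r)` up to `(r, 0)`, the staircase along `x₀ + x₁ = r` up to `(0, r)`, and the
chunked side `x₁ = r` leftwards to `(-r, r)`. [cite: Nolin2008, §4.3 Prop. 12 (proof) (arXiv 0711.4948: Prop. 11)] -/
def thinHalfRing (r e s : ℕ) : List Tube :=
  vchunks r (-(r : ℤ)) e s 0 (r / s) ++ stair r e s 0 (r / s) ++ hchunks 0 r e s 0 (r / s)

/-- **The thin ring road** around `|v| = r`: the half ring followed by its central reflection. [cite: Nolin2008, §4.3 Prop. 12 (proof) (arXiv 0711.4948: Prop. 11)] -/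
def thinRing (r e s : ℕ) : List Tube := thinHalfRing r e s ++ (thinHalfRing r e s).map Tube.neg

section Ring

variable {r e s : ℕ}

/-- At `(r, 0)`: the last piece of the side `x₀ = r` crosses the first step of the staircase
(`n s = r`, `1 ≤ n`). [folklore] -/
theorem crosses_vPiece_last_stairH {n : ℕ} (hn : n * s = r) (hn1 : 1 ≤ n) :
    Crosses (vPiece r (-(r : ℤ)) e s (n - 1)) (stairH r e s 0) := by
  have h : ((n - 1 : ℕ) : ℤ) + 1 = n := by omega
  have hn' : (n : ℤ) * s = r := by exact_mod_cast hn
  have hs : (0 : ℤ) ≤ s := by positivity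
  refine Or.inr ⟨rfl, rfl, ?_, ?_, ?_, ?_⟩ <;> simp only [vPiece, stairH] <;> push_cast <;> nlinarith [h, hn']

/-- At `(0, r)`: the last step of the staircase crosses the first piece of the side `x₁ = r`. [folklore] -/
theorem crosses_stairV_last_hPiece {n : ℕ} (hn : n * s = r) (hn1 : 1 ≤ n) :
    Crosses (stairV r e s (n - 1)) (hPiece 0 r e s 0) := by
  have h : ((n - 1 : ℕ) : ℤ) + 1 = n := by omega
  have hn' : (n : ℤ) * s = r := by exact_mod_cast hn
  have hs : (0 : ℤ) ≤ s := by positivity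
  refine Or.inr ⟨rfl, rfl, ?_, ?_, ?_, ?_⟩ <;> simp only [stairV, hPiece] <;> push_cast <;> nlinarith [h, hn']

/-- At `(-r, r)`: the last piece of the side `x₁ = r` crosses the first piece of the side `x₀ = -r`
(the reflection of the first piece of the side `x₀ = r`). [folklore] -/
theorem crosses_hPiece_last_neg_vPiece {n : ℕ} (hn : n * s = r) (hn1 : 1 ≤ n) :
    Crosses (hPiece 0 r e s (n - 1)) (vPiece r (-(r : ℤ)) e s 0).neg := by
  have h : ((n - 1 : ℕ) : ℤ) + 1 = n := by omega
  have hn' : (n : ℤ) * s = r := by exact_mod_cast hn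
  have hs : (0 : ℤ) ≤ s := by positivity
  refine Or.inl ⟨rfl, rfl, ?_, ?_, ?_, ?_⟩ <;> simp only [vPiece, hPiece, neg_a, neg_b, neg_w, neg_h] <;> push_cast <;>
    nlinarith [h, hn']

/-- **The thin ring closes up** at `(r, -r)`: the reflection of the last piece of the side `x₁ = r`
crosses the first piece of the side `x₀ = r`. [folklore] -/
theorem crosses_thinRing_close {n : ℕ} (hn : n * s = r) (hn1 : 1 ≤ n) :
    Crosses (hPiece 0 r e s (n - 1)).neg (vPiece r (-(r : ℤ)) e s 0) := by
  have h : ((n - 1 : ℕ) : ℤ) + 1 = n := by omega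
  have hn' : (n : ℤ) * s = r := by exact_mod_cast hn
  have hs : (0 : ℤ) ≤ s := by positivity
  refine Or.inl ⟨rfl, rfl, ?_, ?_, ?_, ?_⟩ <;> simp only [vPiece, hPiece, neg_a, neg_b, neg_w, neg_h] <;> push_cast <;>
    nlinarith [h, hn']

/-- The thin half ring is a chain (`1 ≤ s`, `s ∣ r`, `s ≤ r`). [folklore] -/
theorem isChain_thinHalfRing (hs : 1 ≤ s) (hsr : s ∣ r) (hr : s ≤ r) : List.IsChain Crosses (thinHalfRing r e s) := by
  have hn : (r / s) * s = r := Nat.div_mul_cancel hsr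
  have hr' : 1 ≤ r / s := (Nat.le_div_iff_mul_le hs).2 (by simpa using hr)
  obtain ⟨d, hd⟩ : ∃ d, r / s = d + 1 := ⟨r / s - 1, by omega⟩
  unfold thinHalfRing
  refine List.IsChain.append (List.IsChain.append (isChain_vchunks _ _ e s 0 _) (isChain_stair r e s 0 _) ?_)
    (isChain_hchunks _ _ e s 0 _) ?_
  · intro x hx y hy
    rw [hd, getLast?_vchunks] at hx
    rw [hd, head?_stair] at hy
    simp only [Option.mem_def, Option.some.injEq] at hx hy
    subst hx; subst hy
    have := crosses_vPiece_last_stairH (e := e) hn hr'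
    rwa [hd, Nat.add_sub_cancel, ← Nat.zero_add d] at this
  · intro x hx y hy
    rw [List.getLast?_append, hd, getLast?_stair] at hx
    rw [hd, head?_hchunks] at hy
    simp only [Option.mem_def, Option.some_or, Option.some.injEq] at hx hy
    subst hx; subst hy
    have := crosses_stairV_last_hPiece (e := e) hn hr'
    rwa [hd, Nat.add_sub_cancel, ← Nat.zero_add d] at this

/-- The thin half ring starts with the first piece of the side `x₀ = r` (`1 ≤ r / s`). [folklore] -/
theorem head?_thinHalfRing (hr : 1 ≤ r / s) : (thinHalfRing r e s).head? = some (vPiece r (-(r : ℤ)) e s 0) := by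
  obtain ⟨d, hd⟩ : ∃ d, r / s = d + 1 := ⟨r / s - 1, by omega⟩
  unfold thinHalfRing
  rw [List.head?_append, List.head?_append, hd, head?_vchunks, Option.some_or, Option.some_or]

/-- The thin half ring ends with the last piece of the side `x₁ = r` (`1 ≤ r / s`). [folklore] -/
theorem getLast?_thinHalfRing (hr : 1 ≤ r / s) : (thinHalfRing r e s).getLast? = some (hPiece 0 r e s (r / s - 1)) := by
  obtain ⟨d, hd⟩ : ∃ d, r / s = d + 1 := ⟨r / s - 1, by omega⟩
  unfold thinHalfRing
  rw [List.getLast?_append, hd, getLast?_hchunks, Nat.add_sub_cancel, Nat.zero_add]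
  rfl

/-- **The thin ring is a chain of crossing tubes** (`1 ≤ s`, `s ∣ r`, `s ≤ r`). [cite: Nolin2008, §4.3 Prop. 12 (proof) (arXiv 0711.4948: Prop. 11)] -/
theorem isChain_thinRing (hs : 1 ≤ s) (hsr : s ∣ r) (hr : s ≤ r) : List.IsChain Crosses (thinRing r e s) := by
  have hn : (r / s) * s = r := Nat.div_mul_cancel hsr
  have hr' : 1 ≤ r / s := (Nat.le_div_iff_mul_le hs).2 (by simpa using hr)
  unfold thinRing
  refine List.IsChain.append (isChain_thinHalfRing hs hsr hr) (isChain_map_neg (isChain_thinHalfRing hs hsr hr)) ?_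
  intro x hx y hy
  rw [getLast?_thinHalfRing hr'] at hx
  rw [List.head?_map, head?_thinHalfRing hr'] at hy
  simp only [Option.mem_def, Option.some.injEq, Option.map_some] at hx hy
  subst hx; subst hy
  exact crosses_hPiece_last_neg_vPiece hn hr'

/-- The thin ring starts with the first piece of the side `x₀ = r`. [folklore] -/
theorem head?_thinRing (hr : 1 ≤ r / s) : (thinRing r e s).head? = some (vPiece r (-(r : ℤ)) e s 0) := by
  unfold thinRing; rw [List.head?_append, head?_thinHalfRing hr, Option.some_or]

/-- The thin ring ends with the reflection of the last piece of the side `x₁ = r`. [folklore] -/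
theorem getLast?_thinRing (hr : 1 ≤ r / s) : (thinRing r e s).getLast? = some (hPiece 0 r e s (r / s - 1)).neg := by
  unfold thinRing
  rw [List.getLast?_append, List.getLast?_map, getLast?_thinHalfRing hr, Option.map_some]
  rfl

/-- **The thin ring is a closed chain**: its last tube crosses its first. [folklore] -/
theorem crosses_thinRing_getLast_head (hs : 1 ≤ s) (hsr : s ∣ r) (hr : s ≤ r) :
    ∀ x ∈ (thinRing r e s).getLast?, ∀ y ∈ (thinRing r e s).head?, Crosses x y := by
  have hn : (r / s) * s = r := Nat.div_mul_cancel hsr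
  have hr' : 1 ≤ r / s := (Nat.le_div_iff_mul_le hs).2 (by simpa using hr)
  intro x hx y hy
  rw [getLast?_thinRing hr'] at hx
  rw [head?_thinRing hr'] at hy
  simp only [Option.mem_def, Option.some.injEq] at hx hy
  subst hx; subst hy
  exact crosses_thinRing_close hn hr'

/-- **Arcs of the thin ring are chains.** [cite: Nolin2008, §4.3 Prop. 12 (proof) (arXiv 0711.4948: Prop. 11)] -/
theorem isChain_arc_thinRing (hs : 1 ≤ s) (hsr : s ∣ r) (hr : s ≤ r) (a len : ℕ) :
    List.IsChain Crosses (arc (thinRing r e s) a len) :=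
  isChain_arc (isChain_thinRing hs hsr hr) (crosses_thinRing_getLast_head hs hsr hr) a len

/-- Membership in the thin half ring. [folklore] -/
theorem mem_thinHalfRing {T : Tube} (hT : T ∈ thinHalfRing r e s) :
    T ∈ vchunks r (-(r : ℤ)) e s 0 (r / s) ∨ T ∈ stair r e s 0 (r / s) ∨ T ∈ hchunks 0 r e s 0 (r / s) := by
  unfold thinHalfRing at hT
  simp only [List.mem_append] at hT
  tauto

/-- **The thin ring hugs the hexagon**: every site of its tubes has norm in `[r - s - 2e, r + 2e]`
(`2e ≤ r`). [cite: Nolin2008, §4.3 Prop. 12 (proof) (arXiv 0711.4948: Prop. 11)] -/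
theorem triNorm_mem_of_mem_thinRing (he : 2 * e ≤ r) {T : Tube} (hT : T ∈ thinRing r e s) {v : Site 2} (hv : v ∈ T.box) :
    (r : ℤ) - s - 2 * e ≤ triNorm v ∧ triNorm v ≤ (r : ℤ) + 2 * e := by
  have hj : (0 + r / s) * s ≤ r := by rw [Nat.zero_add]; exact Nat.div_mul_le_self r s
  have hj' : ((0 : ℕ) + (r / s : ℕ) : ℤ) * s ≤ r := by exact_mod_cast hj
  have he' : 2 * (e : ℤ) ≤ r := by exact_mod_cast he
  have hs0 : (0 : ℤ) ≤ s := by positivity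
  have half : ∀ T ∈ thinHalfRing r e s, ∀ v ∈ T.box, (r : ℤ) - s - 2 * e ≤ triNorm v ∧ triNorm v ≤ (r : ℤ) + 2 * e := by
    intro T hT v hv
    rcases mem_thinHalfRing hT with hT | hT | hT
    · have hb := bounds_of_mem_vchunks _ _ e s hT hv
      push_cast at hb
      exact ⟨le_triNorm_iff_lin.2 (Or.inl (by linarith)), triNorm_le_iff_lin.2 ⟨by linarith, by linarith, by linarith,
        by linarith, by linarith, by linarith⟩⟩
    · have := triNorm_mem_of_mem_stair hj hT hv; exact ⟨this.1, this.2.1⟩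
    · have hb := bounds_of_mem_hchunks _ _ e s hT hv
      push_cast at hb
      exact ⟨le_triNorm_iff_lin.2 (Or.inr (Or.inr (Or.inl (by linarith)))), triNorm_le_iff_lin.2 ⟨by linarith, by linarith,
        by linarith, by linarith, by nlinarith, by linarith⟩⟩
  unfold thinRing at hT
  rw [List.mem_append, List.mem_map] at hT
  rcases hT with hT | ⟨T', hT', rfl⟩
  · exact half T hT v hv
  · have := half T' hT' (-v) (mem_box_neg.1 hv)
    rwa [triNorm_neg] at this

/-- **All tubes of the thin ring are small**: aspect ratio at most `ρ` when `s + 2e ≤ 2ρe`, `1 ≤ e`. [folklore] -/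
theorem aspectLE_of_mem_thinRing {ρ : ℕ} (he : 1 ≤ e) (hρ : s + 2 * e ≤ ρ * (2 * e)) {T : Tube}
    (hT : T ∈ thinRing r e s) : T.AspectLE ρ := by
  have half : ∀ T ∈ thinHalfRing r e s, T.AspectLE ρ := by
    intro T hT
    rcases mem_thinHalfRing hT with hT | hT | hT
    · exact aspectLE_of_mem_vchunks _ _ e s he hρ hT
    · exact aspectLE_of_mem_stair he hρ hT
    · exact aspectLE_of_mem_hchunks _ _ e s he hρ hT
  unfold thinRing at hT
  rw [List.mem_append, List.mem_map] at hT
  rcases hT with hT | ⟨T', hT', rfl⟩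
  · exact half T hT
  · exact aspectLE_neg (half T' hT')

/-- Length of the thin half ring: `6n - 2` tubes (`n = r/s ≥ 1`). [folklore] -/
theorem length_thinHalfRing (hr : 1 ≤ r / s) : (thinHalfRing r e s).length = 6 * (r / s) - 2 := by
  obtain ⟨d, hd⟩ : ∃ d, r / s = d + 1 := ⟨r / s - 1, by omega⟩
  unfold thinHalfRing
  rw [List.length_append, List.length_append, hd, length_vchunks, length_stair, length_hchunks]
  omega

/-- Length of the thin ring: `12n - 4` tubes. [folklore] -/
theorem length_thinRing (hr : 1 ≤ r / s) : (thinRing r e s).length = 12 * (r / s) - 4 := by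
  unfold thinRing; rw [List.length_append, List.length_map, length_thinHalfRing hr]; omega

end Ring

end Literature.Probability.Percolation
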